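import Mathlib
import HarnessLib
import Summits.ValiantsHypothesis.ValiantsHypothesis.Theorems.SymmetryDialBentTables
import Summits.ValiantsHypothesis.ValiantsHypothesis.Theorems.SymmetryDialBent
import Literature.Computability.AlgebraicComplexity.ThreeByThreeGenericRestriction

/-!
# SymmetryDial — the bijections with prescribed values for the Duplicator of (B)

Route `SymmetryDial` (workshop `decomp-valiant`, lens 1, gen 8), item 23711 (P′ = `AffinePebblePairs`);
kernel plan NODE-g8 §5(a) for (B) `SymmetryDialBent.BentCThreeBlind`; sequel of
`Theorems/SymmetryDialBentTables.lean`.  In the bijective `3`-pebble game on the affine matrix structures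
of two group matrices `M_f, M_g` Duplicator must answer, in a position with at most two pebbled pairs, with
ONE bijection of points ⊔ duals that sends pebbled elements to their partners and preserves the colour of
the new element relative to the pebbled ones.  The four cases, as pure existence statements over `𝔽₂^d`:
* `exists_equiv_shift` — two pebbled points `a ↦ a'`, `a+u ↦ a'+u'`, answering a point: colour
  `(f(a+c), f(a+u+c))`; needs equal weights, balanced derivatives at `u, u'` (bent), `f 0 = g 0`, `f u = g u'`;
* `exists_equiv_hyp` — a pebbled point and a pebbled dual `θ ↦ θ'`, answering a point: colour
  `(f(a+c), [θ·(a+c) = 0])`; needs equal weights, `kerCount f θ = kerCount g θ'`, `f 0 = g 0`;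
* `exists_equiv_colour` — one prescribed value, one Boolean colour (answering a dual facing a pebbled dual,
  with `F, G` the dual bent functions; or a point facing one pebbled point);
* `exists_equiv_dual` — two pebbled points, answering a dual: colour `(F η, [η·u = 0])` with `F` the dual
  bent function; needs `wt F = wt G` and `kerCount F u = kerCount G u'`.
§2 specialises them to BENT `f, g` with `wt f = wt g`, `f 0 = g 0` (the hypotheses of (B)) and their duals
(`exists_equiv_shift_bent`, `wt_dual_eq`, `kerCount_dual_eq`, `exists_equiv_dual_bent`,
`exists_equiv_dual_colour_bent`, `exists_equiv_hyp_of_walsh_eq`).  The position invariant and the game itself (pattern of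
`SymmetryDialAffinePebbleTwo.lean`) are the next file.
Nothing here bears on VP ≠ VNP (LADDER-Valiant rung 0); instrument-side infrastructure for P′.
-/

namespace Summit.ValiantsHypothesis.ValiantsHypothesis.Theorems.SymmetryDialBentBijections

open Finset
open SymmetryDialAffinePebble (V pair)
open SymmetryDialAffinePebbleThree (kerCount)
open SymmetryDialTranslationOrbits (card_V)
open SymmetryDialWalsh (sgn walsh wt)
open SymmetryDialBentTables (exists_equiv_fiber_extending card_fiber_eq_filter ind sum_ind four_mul_card_shift
  two_mul_card_hyp hypTable kerCount_eq_of_walsh_eq)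
open SymmetryDialBent (IsBent)

variable {d : ℕ}

/-! ### 1. The four bijections -/

/-- `a + u = a` forces `u = 0`. -/
theorem eq_zero_of_add_eq_self {a u : V d} (h : a + u = a) : u = 0 := by
  have h2 : a + (a + u) = a + a := by rw [h]
  rwa [← add_assoc, SymmetryDialPerCongruence.two_nsmul_eq_zero, zero_add] at h2

/-- Translating a filter by `a` does not change its cardinality. -/
theorem card_filter_translate (P : V d → Prop) [DecidablePred P] (a : V d) :
    ((univ : Finset (V d)).filter fun c => P (a + c)).card = ((univ : Finset (V d)).filter P).card := by
  refine card_bij (fun c _ => a + c) (fun c hc => ?_) (fun c₁ _ c₂ _ h => ?_) (fun x hx => ?_)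
  · simpa using hc
  · exact add_left_cancel h
  · refine ⟨a + x, ?_, ?_⟩
    · simp only [mem_filter, mem_univ, true_and] at hx ⊢
      rwa [← add_assoc, SymmetryDialPerCongruence.two_nsmul_eq_zero, zero_add]
    · rw [← add_assoc, SymmetryDialPerCongruence.two_nsmul_eq_zero, zero_add]

/-- **Shift bijection** (positions with two pebbled points `a ↦ a'`, `a + u ↦ a' + u'`).  If `f, g` have
the same weight, balanced derivatives in the directions `u ≠ 0`, `u' ≠ 0`, `f 0 = g 0` and `f u = g u'`,
there is a bijection `e` of the points with `e a = a'`, `e (a+u) = a'+u'` and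
`(f(a+c), f(a+u+c)) = (g(a'+e c), g(a'+u'+e c))` for every `c`. -/
theorem exists_equiv_shift (f g : V d → Bool) {u u' : V d} (hu : u ≠ 0) (hu' : u' ≠ 0)
    (hwt : wt f = wt g) (hf : ∑ x, sgn f x * sgn f (x + u) = 0) (hg : ∑ x, sgn g x * sgn g (x + u') = 0)
    (h0 : f 0 = g 0) (hval : f u = g u') (a a' : V d) :
    ∃ e : V d ≃ V d, e a = a' ∧ e (a + u) = a' + u' ∧
      ∀ c, f (a + c) = g (a' + e c) ∧ f (a + u + c) = g (a' + u' + e c) := by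
  classical
  let κ : V d → Bool × Bool := fun c => (f (a + c), f (a + u + c))
  let κ' : V d → Bool × Bool := fun c => (g (a' + c), g (a' + u' + c))
  have hfib : ∀ v : Bool × Bool, Fintype.card {c // κ c = v} = Fintype.card {c // κ' c = v} := by
    rintro ⟨i, j⟩
    rw [card_fiber_eq_filter, card_fiber_eq_filter]
    have e1 : ((univ : Finset (V d)).filter fun c => κ c = (i, j)) =
        (univ.filter fun c => (fun x => f x = i ∧ f (x + u) = j) (a + c)) := by
      refine filter_congr fun c _ => ?_
      simp only [κ, Prod.mk.injEq]
      rw [show a + u + c = a + c + u by abel]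
    have e2 : ((univ : Finset (V d)).filter fun c => κ' c = (i, j)) =
        (univ.filter fun c => (fun x => g x = i ∧ g (x + u') = j) (a' + c)) := by
      refine filter_congr fun c _ => ?_
      simp only [κ', Prod.mk.injEq]
      rw [show a' + u' + c = a' + c + u' by abel]
    rw [e1, e2, card_filter_translate (fun x => f x = i ∧ f (x + u) = j) a,
      card_filter_translate (fun x => g x = i ∧ g (x + u') = j) a']
    have h4 := four_mul_card_shift f u hf i j
    have h4' := four_mul_card_shift g u' hg i j
    rw [← hwt] at h4'
    have : (4 : ℤ) * ((univ.filter fun x => f x = i ∧ f (x + u) = j).card : ℤ) =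
        4 * ((univ.filter fun x => g x = i ∧ g (x + u') = j).card : ℤ) := by rw [h4, h4']
    exact_mod_cast (mul_right_injective₀ (by norm_num : (4 : ℤ) ≠ 0) this)
  let p : Bool → V d := fun b => if b then a + u else a
  let q : Bool → V d := fun b => if b then a' + u' else a'
  have hp : Function.Injective p := by
    intro b₁ b₂ hb
    cases b₁ <;> cases b₂
    · rfl
    · exact absurd (eq_zero_of_add_eq_self (show a + u = a from hb.symm)) hu
    · exact absurd (eq_zero_of_add_eq_self (show a + u = a from hb)) hu
    · rfl
  have hq : Function.Injective q := by
    intro b₁ b₂ hb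
    cases b₁ <;> cases b₂
    · rfl
    · exact absurd (eq_zero_of_add_eq_self (show a' + u' = a' from hb.symm)) hu'
    · exact absurd (eq_zero_of_add_eq_self (show a' + u' = a' from hb)) hu'
    · rfl
  have hpq : ∀ b, κ' (q b) = κ (p b) := by
    intro b
    cases b <;> simp only [κ, κ', p, q, if_true, if_false, Bool.false_eq_true]
    · rw [SymmetryDialPerCongruence.two_nsmul_eq_zero, SymmetryDialPerCongruence.two_nsmul_eq_zero, show a + u + a = u by
        rw [add_comm, ← add_assoc, SymmetryDialPerCongruence.two_nsmul_eq_zero, zero_add],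
        show a' + u' + a' = u' by rw [add_comm, ← add_assoc, SymmetryDialPerCongruence.two_nsmul_eq_zero, zero_add], h0, hval]
    · rw [SymmetryDialPerCongruence.two_nsmul_eq_zero, SymmetryDialPerCongruence.two_nsmul_eq_zero, show a + (a + u) = u by
        rw [← add_assoc, SymmetryDialPerCongruence.two_nsmul_eq_zero, zero_add],
        show a' + (a' + u') = u' by rw [← add_assoc, SymmetryDialPerCongruence.two_nsmul_eq_zero, zero_add], h0, hval]
  obtain ⟨e, he, hep⟩ := exists_equiv_fiber_extending κ κ' hfib p q hp hq hpq
  refine ⟨e, by simpa [p, q] using hep false, by simpa [p, q] using hep true, fun c => ?_⟩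
  have := he c
  simp only [κ, κ', Prod.mk.injEq] at this
  exact ⟨this.1.symm, this.2.symm⟩

/-- **Hyperplane bijection** (positions with a pebbled point `a ↦ a'` and a pebbled dual `θ ↦ θ'`).  If
`wt f = wt g`, `kerCount f θ = kerCount g θ'` (`θ, θ' ≠ 0`) and `f 0 = g 0`, there is a bijection `e` of
the points with `e a = a'`, `f(a+c) = g(a'+e c)` and `θ·(a+c) = 0 ↔ θ'·(a'+e c) = 0` for every `c`. -/
theorem exists_equiv_hyp (f g : V d → Bool) {θ θ' : V d} (hθ : θ ≠ 0) (hθ' : θ' ≠ 0)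
    (hwt : wt f = wt g) (hker : kerCount f θ = kerCount g θ') (h0 : f 0 = g 0) (a a' : V d) :
    ∃ e : V d ≃ V d, e a = a' ∧
      ∀ c, f (a + c) = g (a' + e c) ∧ (pair θ (a + c) = 0 ↔ pair θ' (a' + e c) = 0) := by
  classical
  let κ : V d → Bool × Bool := fun c => (f (a + c), decide (pair θ (a + c) = 0))
  let κ' : V d → Bool × Bool := fun c => (g (a' + c), decide (pair θ' (a' + c) = 0))
  have hfib : ∀ v : Bool × Bool, Fintype.card {c // κ c = v} = Fintype.card {c // κ' c = v} := by
    rintro ⟨i, j⟩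
    rw [card_fiber_eq_filter, card_fiber_eq_filter]
    have e1 : ((univ : Finset (V d)).filter fun c => κ c = (i, j)) =
        (univ.filter fun c => (fun x => f x = i ∧ decide (pair θ x = 0) = j) (a + c)) := by
      refine filter_congr fun c _ => ?_
      simp only [κ, Prod.mk.injEq]
    have e2 : ((univ : Finset (V d)).filter fun c => κ' c = (i, j)) =
        (univ.filter fun c => (fun x => g x = i ∧ decide (pair θ' x = 0) = j) (a' + c)) := by
      refine filter_congr fun c _ => ?_
      simp only [κ', Prod.mk.injEq]
    rw [e1, e2, card_filter_translate (fun x => f x = i ∧ decide (pair θ x = 0) = j) a,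
      card_filter_translate (fun x => g x = i ∧ decide (pair θ' x = 0) = j) a']
    have h2 := two_mul_card_hyp f hθ i j
    have h2' := two_mul_card_hyp g hθ' i j
    rw [← hwt, ← hker] at h2'
    have : (2 : ℤ) * ((univ.filter fun x => f x = i ∧ decide (pair θ x = 0) = j).card : ℤ) =
        2 * ((univ.filter fun x => g x = i ∧ decide (pair θ' x = 0) = j).card : ℤ) := by rw [h2, h2']
    exact_mod_cast (mul_right_injective₀ (by norm_num : (2 : ℤ) ≠ 0) this)
  let p : Unit → V d := fun _ => a
  let q : Unit → V d := fun _ => a'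
  have hp : Function.Injective p := fun _ _ _ => rfl
  have hq : Function.Injective q := fun _ _ _ => rfl
  have hpq : ∀ i, κ' (q i) = κ (p i) := by
    intro _
    simp only [κ, κ', p, q, SymmetryDialPerCongruence.two_nsmul_eq_zero, h0, SymmetryDialTranslationOrbits.pair_zero_right]
  obtain ⟨e, he, hep⟩ := exists_equiv_fiber_extending κ κ' hfib p q hp hq hpq
  refine ⟨e, hep (), fun c => ?_⟩
  have := he c
  simp only [κ, κ', Prod.mk.injEq, decide_eq_decide] at this
  exact ⟨this.1.symm, this.2.symm⟩

/-- `#{F = false} = 2^d − wt F`. -/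
theorem card_false_eq (F : V d → Bool) :
    (((univ : Finset (V d)).filter fun η => F η = false).card : ℤ) = 2 ^ d - (wt F : ℤ) := by
  have h1 : (((univ : Finset (V d)).filter fun η => F η = false).card : ℤ) = ∑ η, (1 - ind (F η)) := by
    rw [← sum_boole]
    exact sum_congr rfl fun η _ => by unfold ind; cases F η <;> simp
  rw [h1, sum_sub_distrib, sum_ind, sum_const, card_univ, card_V, nsmul_eq_mul, mul_one]
  push_cast; rfl

/-- **Plain colour bijection with one prescribed value** (positions with one pebbled element of the sort
being answered): colourings `F, G : V d → Bool` of equal weight and `θ ↦ θ'` with `F θ = G θ'` admit a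
bijection `e` with `e θ = θ'` and `F = G ∘ e`.  (Used for the duals, with `F, G` the dual bent functions,
and for the points with `F = f (a + ·)`.) -/
theorem exists_equiv_colour (F G : V d → Bool) (hwt : wt F = wt G) {θ θ' : V d} (hval : F θ = G θ') :
    ∃ e : V d ≃ V d, e θ = θ' ∧ ∀ η, F η = G (e η) := by
  classical
  have hfib : ∀ b : Bool, Fintype.card {η // F η = b} = Fintype.card {η // G η = b} := by
    intro b
    rw [card_fiber_eq_filter, card_fiber_eq_filter]
    cases b
    · have : (((univ : Finset (V d)).filter fun η => F η = false).card : ℤ) =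
          ((univ : Finset (V d)).filter fun η => G η = false).card := by
        rw [card_false_eq, card_false_eq, hwt]
      exact_mod_cast this
    · change wt F = wt G; exact hwt
  let p : Unit → V d := fun _ => θ
  let q : Unit → V d := fun _ => θ'
  obtain ⟨e, he, hep⟩ := exists_equiv_fiber_extending F G hfib p q (fun _ _ _ => rfl) (fun _ _ _ => rfl)
    (fun _ => hval.symm)
  exact ⟨e, hep (), fun η => (he η).symm⟩

/-- **Two-colour bijection on the duals** (positions with two pebbled points `a, b ↦ a', b'`, answering
a dual): colourings `F, G` (the dual bent functions) of equal weight with `kerCount F u = kerCount G u'`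
for `u = a + b ≠ 0`, `u' = a' + b' ≠ 0` and `F 0 = G 0` admit a bijection `e` of the duals with `e 0 = 0` (the zero dual is `C³`-definable,
so Duplicator must fix it), `F η = G (e η)` and `η·u = 0 ↔ (e η)·u' = 0`.  (By the symmetry of `pair`, `#{η : F η = i, η·u = j}` is the hyperplane table of
`(F, u)`.) -/
theorem exists_equiv_dual (F G : V d → Bool) {u u' : V d} (hu : u ≠ 0) (hu' : u' ≠ 0)
    (hwt : wt F = wt G) (hker : kerCount F u = kerCount G u') (h0 : F 0 = G 0) :
    ∃ e : V d ≃ V d, e 0 = 0 ∧ ∀ η, F η = G (e η) ∧ (pair η u = 0 ↔ pair (e η) u' = 0) := by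
  classical
  have key : ∀ (H : V d → Bool) (v : V d), wt H = wt F → kerCount H v = kerCount F u → v ≠ 0 →
      ∀ i j, 2 * (((univ : Finset (V d)).filter fun η => H η = i ∧ decide (pair η v = 0) = j).card : ℤ) =
        hypTable (2 ^ d) (wt F) (kerCount F u) i j := by
    intro H v hw hk hv i j
    have h2 := two_mul_card_hyp H hv i j
    rw [hw, hk] at h2
    have hflt : ((univ : Finset (V d)).filter fun η => H η = i ∧ decide (pair η v = 0) = j) =
        (univ.filter fun η => H η = i ∧ decide (pair v η = 0) = j) :=
      filter_congr fun η _ => by rw [SymmetryDialWalsh.pair_comm η v]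
    rw [hflt]
    exact h2
  let κ : V d → Bool × Bool := fun η => (F η, decide (pair η u = 0))
  let κ' : V d → Bool × Bool := fun η => (G η, decide (pair η u' = 0))
  have hfib : ∀ v : Bool × Bool, Fintype.card {c // κ c = v} = Fintype.card {c // κ' c = v} := by
    rintro ⟨i, j⟩
    rw [card_fiber_eq_filter, card_fiber_eq_filter]
    have e1 : ((univ : Finset (V d)).filter fun η => κ η = (i, j)) =
        (univ.filter fun η => F η = i ∧ decide (pair η u = 0) = j) :=
      filter_congr fun η _ => by simp only [κ, Prod.mk.injEq]
    have e2 : ((univ : Finset (V d)).filter fun η => κ' η = (i, j)) =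
        (univ.filter fun η => G η = i ∧ decide (pair η u' = 0) = j) :=
      filter_congr fun η _ => by simp only [κ', Prod.mk.injEq]
    rw [e1, e2]
    have h2 := key F u rfl rfl hu i j
    have h2' := key G u' hwt.symm hker.symm hu' i j
    have : (2 : ℤ) * ((univ.filter fun η => F η = i ∧ decide (pair η u = 0) = j).card : ℤ) =
        2 * ((univ.filter fun η => G η = i ∧ decide (pair η u' = 0) = j).card : ℤ) := by rw [h2, h2']
    exact_mod_cast (mul_right_injective₀ (by norm_num : (2 : ℤ) ≠ 0) this)
  obtain ⟨e, he, hep⟩ := exists_equiv_fiber_extending κ κ' hfib (fun _ : Unit => (0 : V d))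
    (fun _ : Unit => (0 : V d)) (fun _ _ _ => rfl) (fun _ _ _ => rfl)
    (fun _ => by simp only [κ, κ', h0, SymmetryDialTranslationOrbits.pair_zero_left])
  refine ⟨e, hep (), fun η => ?_⟩
  have := he η
  simp only [κ, κ', Prod.mk.injEq, decide_eq_decide] at this
  exact ⟨this.1.symm, this.2.symm⟩

/-- **Plain colour bijection with two prescribed values** (answering a dual facing two pebbled duals). -/
theorem exists_equiv_colour₂ (F G : V d → Bool) (hwt : wt F = wt G) {θ₁ θ₂ θ₁' θ₂' : V d}
    (hne : θ₁ ≠ θ₂) (hne' : θ₁' ≠ θ₂') (h₁ : F θ₁ = G θ₁') (h₂ : F θ₂ = G θ₂') :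
    ∃ e : V d ≃ V d, e θ₁ = θ₁' ∧ e θ₂ = θ₂' ∧ ∀ η, F η = G (e η) := by
  classical
  have hfib : ∀ b : Bool, Fintype.card {η // F η = b} = Fintype.card {η // G η = b} := by
    intro b
    rw [card_fiber_eq_filter, card_fiber_eq_filter]
    cases b
    · have : (((univ : Finset (V d)).filter fun η => F η = false).card : ℤ) =
          ((univ : Finset (V d)).filter fun η => G η = false).card := by
        rw [card_false_eq, card_false_eq, hwt]
      exact_mod_cast this
    · change wt F = wt G; exact hwt
  let p : Bool → V d := fun b => if b then θ₂ else θ₁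
  let q : Bool → V d := fun b => if b then θ₂' else θ₁'
  have hp : Function.Injective p := by
    intro b₁ b₂ hb; cases b₁ <;> cases b₂ <;> simp [p] at hb ⊢ <;> [exact hne hb; exact hne hb.symm]
  have hq : Function.Injective q := by
    intro b₁ b₂ hb; cases b₁ <;> cases b₂ <;> simp [q] at hb ⊢ <;> [exact hne' hb; exact hne' hb.symm]
  obtain ⟨e, he, hep⟩ := exists_equiv_fiber_extending F G hfib p q hp hq
    (fun b => by cases b <;> simp [p, q, h₁, h₂])
  exact ⟨e, by simpa [p, q] using hep false, by simpa [p, q] using hep true, fun η => (he η).symm⟩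

/-- **Plain colour bijection with three prescribed values** (answering a dual facing two pebbled duals,
the zero dual being always prescribed). -/
theorem exists_equiv_colour₃ (F G : V d → Bool) (hwt : wt F = wt G) {θ₁ θ₂ θ₃ θ₁' θ₂' θ₃' : V d}
    (h12 : θ₁ ≠ θ₂) (h13 : θ₁ ≠ θ₃) (h23 : θ₂ ≠ θ₃) (h12' : θ₁' ≠ θ₂') (h13' : θ₁' ≠ θ₃')
    (h23' : θ₂' ≠ θ₃') (h₁ : F θ₁ = G θ₁') (h₂ : F θ₂ = G θ₂') (h₃ : F θ₃ = G θ₃') :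
    ∃ e : V d ≃ V d, e θ₁ = θ₁' ∧ e θ₂ = θ₂' ∧ e θ₃ = θ₃' ∧ ∀ η, F η = G (e η) := by
  classical
  have hfib : ∀ b : Bool, Fintype.card {η // F η = b} = Fintype.card {η // G η = b} := by
    intro b
    rw [card_fiber_eq_filter, card_fiber_eq_filter]
    cases b
    · have : (((univ : Finset (V d)).filter fun η => F η = false).card : ℤ) =
          ((univ : Finset (V d)).filter fun η => G η = false).card := by
        rw [card_false_eq, card_false_eq, hwt]
      exact_mod_cast this
    · change wt F = wt G; exact hwt
  have hp : Function.Injective ![θ₁, θ₂, θ₃] := Literature.Computability.AlgebraicComplexity.injective_vec_three h12 h13 h23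
  have hq : Function.Injective ![θ₁', θ₂', θ₃'] := Literature.Computability.AlgebraicComplexity.injective_vec_three h12' h13' h23'
  obtain ⟨e, he, hep⟩ := exists_equiv_fiber_extending F G hfib ![θ₁, θ₂, θ₃] ![θ₁', θ₂', θ₃'] hp hq
    (fun m => by fin_cases m <;> simp [h₁, h₂, h₃])
  exact ⟨e, by simpa using hep 0, by simpa using hep 1, by simpa using hep 2, fun η => (he η).symm⟩

/-- Weight is translation invariant: `wt (f (a + ·)) = wt f`. -/
theorem wt_translate (f : V d → Bool) (a : V d) : wt (fun c => f (a + c)) = wt f := by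
  unfold wt
  exact card_filter_translate (fun x => f x = true) a

/-- **One pebbled point, answering a point**: `wt f = wt g`, `f 0 = g 0` give a bijection `e` with
`e a = a'` and `f(a+c) = g(a'+e c)`. -/
theorem exists_equiv_point (f g : V d → Bool) (hwt : wt f = wt g) (h0 : f 0 = g 0) (a a' : V d) :
    ∃ e : V d ≃ V d, e a = a' ∧ ∀ c, f (a + c) = g (a' + e c) := by
  have h := exists_equiv_colour (fun c => f (a + c)) (fun c => g (a' + c))
    (by rw [wt_translate, wt_translate, hwt]) (θ := a) (θ' := a')
    (by simp only [SymmetryDialPerCongruence.two_nsmul_eq_zero, h0])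
  exact h

/-! ### 2. Specialisation to bent functions and their duals -/

/-- Shift bijection for bent `f, g` (balanced derivatives come for free). -/
theorem exists_equiv_shift_bent {f g : V d → Bool} (hf : IsBent f) (hg : IsBent g) {u u' : V d}
    (hu : u ≠ 0) (hu' : u' ≠ 0) (hwt : wt f = wt g) (h0 : f 0 = g 0) (hval : f u = g u') (a a' : V d) :
    ∃ e : V d ≃ V d, e a = a' ∧ e (a + u) = a' + u' ∧
      ∀ c, f (a + c) = g (a' + e c) ∧ f (a + u + c) = g (a' + u' + e c) :=
  exists_equiv_shift f g hu hu' hwt (hf.autocorr hu) (hg.autocorr hu') h0 hval a a'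

/-- Hyperplane bijection for `f, g` of equal weight and pebbled duals with EQUAL WALSH COEFFICIENTS
(the invariant (p3) of the game: `W_f(θ) = W_g(θ')`). -/
theorem exists_equiv_hyp_of_walsh_eq (f g : V d → Bool) {θ θ' : V d} (hθ : θ ≠ 0) (hθ' : θ' ≠ 0)
    (hwt : wt f = wt g) (hW : walsh f θ = walsh g θ') (h0 : f 0 = g 0) (a a' : V d) :
    ∃ e : V d ≃ V d, e a = a' ∧
      ∀ c, f (a + c) = g (a' + e c) ∧ (pair θ (a + c) = 0 ↔ pair θ' (a' + e c) = 0) :=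
  exists_equiv_hyp f g hθ hθ' hwt (kerCount_eq_of_walsh_eq f g hθ hθ' hwt hW) h0 a a'

/-- The duals of bent `f, g` with `f 0 = g 0` have equal weights. -/
theorem wt_dual_eq {f g fd gd : V d → Bool} (hf : IsBent f) (hg : IsBent g)
    (hfd : ∀ ξ, walsh f ξ = 2 ^ (d / 2) * sgn fd ξ) (hgd : ∀ ξ, walsh g ξ = 2 ^ (d / 2) * sgn gd ξ)
    (h0 : f 0 = g 0) : wt fd = wt gd := by
  have h1 := hf.dual_wt_eq_zero hfd
  have h2 := hg.dual_wt_eq_zero hgd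
  have hs : sgn f 0 = sgn g 0 := by unfold sgn; rw [h0]
  rw [hs] at h1
  have : (wt fd : ℤ) = wt gd := by linarith
  exact_mod_cast this

/-- The duals of bent `f, g` with `f 0 = g 0` and `f u = g u'` (`u, u' ≠ 0`) have
`kerCount fd u = kerCount gd u'`. -/
theorem kerCount_dual_eq {f g fd gd : V d → Bool} (hf : IsBent f) (hg : IsBent g)
    (hfd : ∀ ξ, walsh f ξ = 2 ^ (d / 2) * sgn fd ξ) (hgd : ∀ ξ, walsh g ξ = 2 ^ (d / 2) * sgn gd ξ)
    {u u' : V d} (hu : u ≠ 0) (hu' : u' ≠ 0) (h0 : f 0 = g 0) (hval : f u = g u') :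
    kerCount fd u = kerCount gd u' :=
  kerCount_eq_of_walsh_eq fd gd hu hu' (wt_dual_eq hf hg hfd hgd h0)
    (by rw [hf.walsh_dual hfd, hg.walsh_dual hgd]; unfold sgn; rw [hval])

/-- The duals of bent `f, g` of equal weight agree at the zero dual: `fd 0 = gd 0`
(`W_f(0) = 2^d − 2·wt f`). -/
theorem dual_zero_eq {f g fd gd : V d → Bool}
    (hfd : ∀ ξ, walsh f ξ = 2 ^ (d / 2) * sgn fd ξ) (hgd : ∀ ξ, walsh g ξ = 2 ^ (d / 2) * sgn gd ξ)
    (hwt : wt f = wt g) : fd 0 = gd 0 := by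
  have h1 := hfd 0
  have h2 := hgd 0
  rw [SymmetryDialWalsh.walsh_zero] at h1 h2
  rw [hwt, h2] at h1
  have hpos : (2 : ℤ) ^ (d / 2) ≠ 0 := by positivity
  have h3 := mul_left_cancel₀ hpos h1
  unfold sgn at h3
  cases hθ : fd 0 <;> cases hθ' : gd 0 <;> simp [hθ, hθ'] at h3 ⊢

/-- Dual-side bijection for bent `f, g` (two pebbled points with difference `u ↦ u'`, answering a dual):
a bijection of the duals matching the dual functions (equivalently the signs of the Walsh coefficients)
and the incidence with `u`, `u'`. -/
theorem exists_equiv_dual_bent {f g fd gd : V d → Bool} (hf : IsBent f) (hg : IsBent g)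
    (hfd : ∀ ξ, walsh f ξ = 2 ^ (d / 2) * sgn fd ξ) (hgd : ∀ ξ, walsh g ξ = 2 ^ (d / 2) * sgn gd ξ)
    {u u' : V d} (hu : u ≠ 0) (hu' : u' ≠ 0) (hwt : wt f = wt g) (h0 : f 0 = g 0) (hval : f u = g u') :
    ∃ e : V d ≃ V d, e 0 = 0 ∧ ∀ η, fd η = gd (e η) ∧ (pair η u = 0 ↔ pair (e η) u' = 0) :=
  exists_equiv_dual fd gd hu hu' (wt_dual_eq hf hg hfd hgd h0) (kerCount_dual_eq hf hg hfd hgd hu hu' h0 hval)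
    (dual_zero_eq hfd hgd hwt)

/-- Dual-side bijection with a prescribed dual `θ ↦ θ'` of the same sign (`fd θ = gd θ'`), for bent
`f, g` with `f 0 = g 0`. -/
theorem exists_equiv_dual_colour_bent {f g fd gd : V d → Bool} (hf : IsBent f) (hg : IsBent g)
    (hfd : ∀ ξ, walsh f ξ = 2 ^ (d / 2) * sgn fd ξ) (hgd : ∀ ξ, walsh g ξ = 2 ^ (d / 2) * sgn gd ξ)
    (h0 : f 0 = g 0) {θ θ' : V d} (hθ : fd θ = gd θ') :
    ∃ e : V d ≃ V d, e θ = θ' ∧ ∀ η, fd η = gd (e η) :=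
  exists_equiv_colour fd gd (wt_dual_eq hf hg hfd hgd h0) hθ

/-- Matching dual values is matching Walsh coefficients. -/
theorem dual_eq_iff_walsh_eq {f g fd gd : V d → Bool}
    (hfd : ∀ ξ, walsh f ξ = 2 ^ (d / 2) * sgn fd ξ) (hgd : ∀ ξ, walsh g ξ = 2 ^ (d / 2) * sgn gd ξ)
    (θ θ' : V d) : fd θ = gd θ' ↔ walsh f θ = walsh g θ' := by
  rw [hfd, hgd]
  have hpos : (2 : ℤ) ^ (d / 2) ≠ 0 := by positivity
  constructor
  · intro h; unfold sgn; rw [h]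
  · intro h
    have h2 := mul_left_cancel₀ hpos h
    unfold sgn at h2
    cases hθ : fd θ <;> cases hθ' : gd θ' <;> simp [hθ, hθ'] at h2 ⊢

end Summit.ValiantsHypothesis.ValiantsHypothesis.Theorems.SymmetryDialBentBijections
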